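import Summits.QuantumFields.YangMills.Theorems.FluctuationComparisonRegPrIntLS2BetaSeamSectorMinimisers
import HarnessLib

/-!
# (RG-K) THE ℤ₂ SEAM TWIST, X — POINTWISE TRANSPORT FROM THE FLAT DATUM TO EVERY CASE-B `(V, U₀)`, PREFIX-AGNOSTIC AND WITH AN ARBITRARY INVARIANT GUARD:
# whatever growth inequality (TUBE♭-shape or GAP♭-shape, any constant `c`, any radius `δ`, optionally guarded by a fine-field predicate `P` invariant under gauge
# transformations and seam twists) holds at `(1, 1)` for FIXED `(F, γ, b₀, p₀, J, K, ε₀)` holds, with the SAME `(c, δ)`, at `(V, U₀)` for every case-B `2`-small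
# datum `V` and every R2-critical `U₀ ∈ regFibrePr ε₀ V`

Helper for crux `stmt-QuantumFields-20520` (`Theses.UnitScaleTilt.FluctuationComparisonRegPrIntL`), the (T)-chain of LINE `semiclassical_s2beta` (cell
`ym3-torus`, width seat «width 16» px16 g18).  Parts III–VI transported the PACKAGED letters of ✓p799103 (`∃ γ₁ … ∃ μ …`).  A volume-uniform constant (the
registered TUBE-REG∘ ∕ GAP♯∘ want `∃ μ` BEFORE `∀ F γ J K V U₀`; px12 g22's depth-one programme at the flat datum) needs the transport POINTWISE in all
parameters, so that it commutes with ANY quantifier prefix; and future flat-datum suppliers may carry extra fine-field rows (e.g. `PlaqSmall a U`).  THIS file: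

* §1 guarded equivariance: `gapAt_gaugeAct_iff_guard` (✓(B1)'s proof with a guard `P`, `∀ U, P (u • U) ↔ P U`), `gapAt_seamTwist_iff_guard` (✓(D2)'s proof with
  a guard `P`, `∀ U, P (tw U) ↔ P U`, given `hmin`).
* §2 ★★★★ `gapAt_caseB_of_flat_guard` — GAP-shape with guard: `(1,1) ⟹ (V, U₀)` at fixed `(F, γ, b₀, p₀, J, K, ε₀, c)`, for `V` case B (`PlaqSmall δ V`,
  `δ ≤ 2`), `U₀ ∈ regFibrePr ε₀ V` R2-critical, `0 < ε₀`, `J < K` (∘ ✓(D5) `exists_residual_eq_gaugeAct_seamSectorRep`); ★★★★ `gapFlatAt_caseB_of_flat` ∕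
  ★★★★ `tubeGrowthAt_caseB_of_flat` — the unguarded GAP♭ ∕ TUBE♭ bodies of ✓p799103, pointwise.
  USE: a supplier proving `∃ μ(L) > 0, ∀ F γ … K …, GAP(1, 1, μ)` gets `∃ μ(L) > 0, ∀ F γ … K … V U₀ ⟨case B, critical⟩, GAP(V, U₀, μ)` by ONE application
  inside its own prefix — the constant and its position are untouched.

HONEST: composition of landed letters; nothing of Bałaban's analysis; no constant is produced here; TUBE-REG∘, GAP♯∘ (K-uniform), EXW∘ as registered, S2β and
crux 20520 stay OPEN; rung R3 (YM₃ on T³) is NOT d = 4, NOT infinite volume, NOT a mass gap, NOT Clay; the Yang–Mills mass gap is NOT proved.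
-/

set_option autoImplicit false

noncomputable section

open Set Function
open scoped Matrix.Norms.L2Operator
open Literature.MathematicalPhysics.QuantumFieldTheory.Balaban1983to89
open Literature.MathematicalPhysics.QuantumFieldTheory.Balaban1983to89.T4Continuum
open Literature.MathematicalPhysics.QuantumFieldTheory.Balaban1983to89.T3ContinuumYM3Torus
open Literature.MathematicalPhysics.QuantumFieldTheory.Balaban1983to89.T3UnitLawDensityEML (ℰp)
open Literature.MathematicalPhysics.QuantumFieldTheory.Balaban1983to89.T3UnitScaleTilt
open Literature.MathematicalPhysics.QuantumFieldTheory.Balaban1983to89.T3TiltDescent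
open Literature.MathematicalPhysics.QuantumFieldTheory.Balaban1983to89.T3ConstrainedMinimiser (fibre)
open Literature.MathematicalPhysics.QuantumFieldTheory.Balaban1983to89.T3PrintedRegularMinimiser
open Literature.MathematicalPhysics.QuantumFieldTheory.Balaban1983to89.T3PrintedRegularOrbits
open scoped Literature.MathematicalPhysics.QuantumFieldTheory.Balaban1983to89.T3OrbitAverage
open Literature.MathematicalPhysics.QuantumFieldTheory.Balaban1983to89.T3Thm1CarrierNative (IsCritR2)
open Literature.MathematicalPhysics.QuantumFieldTheory.Balaban1983to89.T4SmallFieldWindowSandwich (gaugeAct_const_one)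
open Summit.QuantumFields.YangMills.Theorems.FluctuationComparisonRegPrIntLS2BetaResidualGauge (gaugeAct_mem_histGood_iff wilsonAction4_gaugeAct)
open Summit.QuantumFields.YangMills.Theorems.FluctuationComparisonRegPrIntLS2BetaTubeRegularSmall (gaugeAct_gaugeAct_inv)
open Summit.QuantumFields.YangMills.Theorems.FluctuationComparisonRegPrIntLS2BetaCriticalOrbitUnique (negOne_mul_comm negOne_mul_negOne)
open Summit.QuantumFields.YangMills.Theorems.BrascampLiebVacuumSC.DimensionGapSU2 (neg_one_mem)
open Summit.QuantumFields.YangMills.Theorems.FluctuationComparisonRegPrIntLS2BetaTubeLettersOrbitTransport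
open Summit.QuantumFields.YangMills.Theorems.FluctuationComparisonRegPrIntLS2BetaSeamTwistDescent
open Summit.QuantumFields.YangMills.Theorems.FluctuationComparisonRegPrIntLS2BetaTubeLettersSeamTwist
open Summit.QuantumFields.YangMills.Theorems.FluctuationComparisonRegPrIntLS2BetaTubeLettersSeamSectors (minActionRegPr_seamFold_one)
open Summit.QuantumFields.YangMills.Theorems.FluctuationComparisonRegPrIntLS2BetaSeamSectorMinimisers (exists_residual_eq_gaugeAct_seamSectorRep)

namespace Summit.QuantumFields.YangMills.Theorems.FluctuationComparisonRegPrIntLS2BetaCaseBTransportPointwise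

variable (F : T3Family) {J K : ℕ} (hJK : J ≤ K)

/-! ## §1 Guarded equivariance of the GAP-shape under gauge transformations and seam twists -/

/-- **GAP-shape WITH AN INVARIANT GUARD is gauge-equivariant**: at `(u↓ • V, u • U₀)` ⟺ at `(V, U₀)`, same `c`, for every fine-field guard `P` with `P (u • U) ↔ P U`
(✓(B1) `gapFlatAt_gaugeAct_iff`'s proof, one extra row). [cite: Balaban1985Variational, (142) p.299, (4) p.278; Balaban1985Averaging, (8)-(11) p.19] -/
theorem gapAt_gaugeAct_iff_guard (u : Site (F.P K) 0 → Matrix.specialUnitaryGroup (Fin 2) ℂ) {γ b₀ p₀ ε₀ : ℝ} (hε₀ : 0 ≤ ε₀)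
    (P : GaugeField (F.P K) 0 (Matrix.specialUnitaryGroup (Fin 2) ℂ) → Prop) (hP : ∀ U : GaugeField (F.P K) 0 (Matrix.specialUnitaryGroup (Fin 2) ℂ), P (GaugeField.gaugeAct u U) ↔ P U)
    (V : GaugeField (F.P J) 0 (Matrix.specialUnitaryGroup (Fin 2) ℂ)) (U₀ : GaugeField (F.P K) 0 (Matrix.specialUnitaryGroup (Fin 2) ℂ)) (c : ℝ) :
    (∀ U ∈ fibre F ℰp J K hJK (GaugeField.gaugeAct (descTransf F J K hJK u) V), U ∈ histGood F ℰp (θBal F.L γ b₀ p₀) K J →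
      P U →
      c * ((F.L : ℝ)⁻¹) ^ (2 * (K - J)) *
        (⨅ w : {w : Site (F.P K) 0 → Matrix.specialUnitaryGroup (Fin 2) ℂ |
            ∀ U : GaugeField (F.P K) 0 (Matrix.specialUnitaryGroup (Fin 2) ℂ),
              descendTo F ℰp J K hJK (GaugeField.gaugeAct w U) = descendTo F ℰp J K hJK U},
          ∑ ℓ : PBond (F.P K) 0,
            dist1 (U ℓ * ((GaugeField.gaugeAct (w : Site (F.P K) 0 → Matrix.specialUnitaryGroup (Fin 2) ℂ) (GaugeField.gaugeAct u U₀)) ℓ)⁻¹) ^ 2)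
        ≤ wilsonAction4 U - minActionRegPr F J K hJK ε₀ (GaugeField.gaugeAct (descTransf F J K hJK u) V)) ↔
    (∀ U ∈ fibre F ℰp J K hJK V, U ∈ histGood F ℰp (θBal F.L γ b₀ p₀) K J →
      P U →
      c * ((F.L : ℝ)⁻¹) ^ (2 * (K - J)) *
        (⨅ w : {w : Site (F.P K) 0 → Matrix.specialUnitaryGroup (Fin 2) ℂ |
            ∀ U : GaugeField (F.P K) 0 (Matrix.specialUnitaryGroup (Fin 2) ℂ),
              descendTo F ℰp J K hJK (GaugeField.gaugeAct w U) = descendTo F ℰp J K hJK U},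
          ∑ ℓ : PBond (F.P K) 0,
            dist1 (U ℓ * ((GaugeField.gaugeAct (w : Site (F.P K) 0 → Matrix.specialUnitaryGroup (Fin 2) ℂ) U₀) ℓ)⁻¹) ^ 2)
        ≤ wilsonAction4 U - minActionRegPr F J K hJK ε₀ V) := by
  rw [minActionRegPr_gaugeAct F hJK hε₀]
  constructor
  · intro h U hUf hUh hPU
    have hU' := (gaugeAct_mem_goodFibre_iff F hJK u (γ := γ) (b₀ := b₀) (p₀ := p₀) V U).2 ⟨hUf, hUh⟩
    have h1 := h (GaugeField.gaugeAct u U) hU'.1 hU'.2 ((hP U).2 hPU)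
    rwa [iInf_orbitDistSq_gaugeAct, wilsonAction4_gaugeAct] at h1
  · intro h U hUf hUh hPU
    obtain ⟨W, rfl⟩ : ∃ W, U = GaugeField.gaugeAct u W := ⟨_, (gaugeAct_gaugeAct_inv F u U).symm⟩
    have hW := (gaugeAct_mem_goodFibre_iff F hJK u (γ := γ) (b₀ := b₀) (p₀ := p₀) V W).1 ⟨hUf, hUh⟩
    have h1 := h W hW.1 hW.2 ((hP W).1 hPU)
    rwa [iInf_orbitDistSq_gaugeAct, wilsonAction4_gaugeAct]

/-- **GAP-shape WITH AN INVARIANT GUARD is seam-twist-equivariant** given `hmin`: at `(tw V, tw U₀)` ⟺ at `(V, U₀)`, same `c`, for every guard `P` with `P (tw U) ↔ P U`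
(✓(D2) `gapFlatAt_seamTwist_iff`'s proof, one extra row). [cite: Balaban1985Variational, (142) p.299, (4)-(6) p.278] -/
theorem gapAt_seamTwist_iff_guard (n1 : Matrix.specialUnitaryGroup (Fin 2) ℂ) (hc : ∀ g, n1 * g = g * n1) (hsq : n1 * n1 = 1) (ν : Fin 3)
    {γ b₀ p₀ ε₀ : ℝ} (P : GaugeField (F.P K) 0 (Matrix.specialUnitaryGroup (Fin 2) ℂ) → Prop) (hP : ∀ U : GaugeField (F.P K) 0 (Matrix.specialUnitaryGroup (Fin 2) ℂ), P (fun b : PBond (F.P K) 0 => (if b.dir = ν ∧ (b.src ν).val + 1 = (F.P K).sitesPerDir 0 then n1 else 1) * U b) ↔ P U)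
    (V : GaugeField (F.P J) 0 (Matrix.specialUnitaryGroup (Fin 2) ℂ)) (U₀ : GaugeField (F.P K) 0 (Matrix.specialUnitaryGroup (Fin 2) ℂ))
    (hmin : minActionRegPr F J K hJK ε₀ (fun c : PBond (F.P J) 0 => (if c.dir = ν ∧ (c.src ν).val + 1 = (F.P J).sitesPerDir 0 then n1 else 1) * V c) = minActionRegPr F J K hJK ε₀ V) (c : ℝ) :
    (∀ U ∈ fibre F ℰp J K hJK (fun c : PBond (F.P J) 0 => (if c.dir = ν ∧ (c.src ν).val + 1 = (F.P J).sitesPerDir 0 then n1 else 1) * V c), U ∈ histGood F ℰp (θBal F.L γ b₀ p₀) K J →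
      P U →
      c * ((F.L : ℝ)⁻¹) ^ (2 * (K - J)) *
        (⨅ w : {w : Site (F.P K) 0 → Matrix.specialUnitaryGroup (Fin 2) ℂ |
            ∀ U : GaugeField (F.P K) 0 (Matrix.specialUnitaryGroup (Fin 2) ℂ),
              descendTo F ℰp J K hJK (GaugeField.gaugeAct w U) = descendTo F ℰp J K hJK U},
          ∑ ℓ : PBond (F.P K) 0,
            dist1 (U ℓ * ((GaugeField.gaugeAct (w : Site (F.P K) 0 → Matrix.specialUnitaryGroup (Fin 2) ℂ) (fun b : PBond (F.P K) 0 => (if b.dir = ν ∧ (b.src ν).val + 1 = (F.P K).sitesPerDir 0 then n1 else 1) * U₀ b)) ℓ)⁻¹) ^ 2)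
        ≤ wilsonAction4 U - minActionRegPr F J K hJK ε₀ (fun c : PBond (F.P J) 0 => (if c.dir = ν ∧ (c.src ν).val + 1 = (F.P J).sitesPerDir 0 then n1 else 1) * V c)) ↔
    (∀ U ∈ fibre F ℰp J K hJK V, U ∈ histGood F ℰp (θBal F.L γ b₀ p₀) K J →
      P U →
      c * ((F.L : ℝ)⁻¹) ^ (2 * (K - J)) *
        (⨅ w : {w : Site (F.P K) 0 → Matrix.specialUnitaryGroup (Fin 2) ℂ |
            ∀ U : GaugeField (F.P K) 0 (Matrix.specialUnitaryGroup (Fin 2) ℂ),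
              descendTo F ℰp J K hJK (GaugeField.gaugeAct w U) = descendTo F ℰp J K hJK U},
          ∑ ℓ : PBond (F.P K) 0,
            dist1 (U ℓ * ((GaugeField.gaugeAct (w : Site (F.P K) 0 → Matrix.specialUnitaryGroup (Fin 2) ℂ) U₀) ℓ)⁻¹) ^ 2)
        ≤ wilsonAction4 U - minActionRegPr F J K hJK ε₀ V) := by
  rw [hmin]
  constructor
  · intro h U hUf hUh hPU
    have hU' := (seamTwist_mem_goodFibre_iff F hJK n1 hc hsq ν (γ := γ) (b₀ := b₀) (p₀ := p₀) V U).2 ⟨hUf, hUh⟩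
    have h1 := h _ hU'.1 hU'.2 ((hP U).2 hPU)
    rwa [iInf_orbitDistSq_seamTwist F hJK n1 hc ν, wilsonAction4_seamTwist (P := F.P K) n1 hc ν] at h1
  · intro h U hUf hUh hPU
    obtain ⟨W, rfl⟩ : ∃ W : GaugeField (F.P K) 0 (Matrix.specialUnitaryGroup (Fin 2) ℂ), U = (fun b : PBond (F.P K) 0 => (if b.dir = ν ∧ (b.src ν).val + 1 = (F.P K).sitesPerDir 0 then n1 else 1) * W b) :=
      ⟨(fun b : PBond (F.P K) 0 => (if b.dir = ν ∧ (b.src ν).val + 1 = (F.P K).sitesPerDir 0 then n1 else 1) * U b), (seamTwist_seamTwist (P := F.P K) n1 hsq ν U).symm⟩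
    have hW := (seamTwist_mem_goodFibre_iff F hJK n1 hc hsq ν (γ := γ) (b₀ := b₀) (p₀ := p₀) V W).1 ⟨hUf, hUh⟩
    have h1 := h W hW.1 hW.2 ((hP W).1 hPU)
    rwa [iInf_orbitDistSq_seamTwist F hJK n1 hc ν, wilsonAction4_seamTwist (P := F.P K) n1 hc ν]

/-! ## §2 Pointwise transport `(1, 1) ⟹ (V, U₀)` for every case-B datum and every R2-critical base point -/

/-- ★★★★ **GUARDED GAP-SHAPE: FROM THE FLAT DATUM TO EVERY CASE-B `(V, U₀)`, POINTWISE** — fixed `(F, γ, b₀, p₀, J, K, ε₀, c)`; the guard `P` invariant under every fine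
gauge transformation and every seam twist by `−1`; `V` with central closed-walk holonomies and `PlaqSmall δ V`, `δ ≤ 2`; `U₀ ∈ regFibrePr ε₀ V` R2-critical; `0 < ε₀`,
`J < K`.  Mechanism: ✓(D5) `exists_residual_eq_gaugeAct_seamSectorRep` (`V = g • ζ_l^J`, `U₀ = u • ((liftTransfTo g) • ζ_l^K)`, `u↓ = 1`); induction over `l` by §1
(`hmin`: both regular minima vanish, ✓`minActionRegPr_seamFold_one`); then §1 along `liftTransfTo g` and along `u`. [cite: Balaban1985Variational, (142) p.299, Prop. 7 p.299, (4)-(6) p.278] -/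
theorem gapAt_caseB_of_flat_guard (hlt : J < K) {γ b₀ p₀ ε₀ : ℝ} (hε₀ : 0 < ε₀)
    (P : GaugeField (F.P K) 0 (Matrix.specialUnitaryGroup (Fin 2) ℂ) → Prop)
    (hPg : ∀ (u : Site (F.P K) 0 → Matrix.specialUnitaryGroup (Fin 2) ℂ) (U : GaugeField (F.P K) 0 (Matrix.specialUnitaryGroup (Fin 2) ℂ)), P (GaugeField.gaugeAct u U) ↔ P U)
    (hPtw : ∀ (ν : Fin 3) (U : GaugeField (F.P K) 0 (Matrix.specialUnitaryGroup (Fin 2) ℂ)),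
      P (fun b : PBond (F.P K) 0 => (if b.dir = ν ∧ (b.src ν).val + 1 = (F.P K).sitesPerDir 0 then (⟨-1, neg_one_mem⟩ : Matrix.specialUnitaryGroup (Fin 2) ℂ) else 1) * U b) ↔ P U)
    (c : ℝ)
    (h1 : (∀ U ∈ fibre F ℰp J K hlt.le (1 : GaugeField (F.P J) 0 (Matrix.specialUnitaryGroup (Fin 2) ℂ)), U ∈ histGood F ℰp (θBal F.L γ b₀ p₀) K J →
      P U →
      c * ((F.L : ℝ)⁻¹) ^ (2 * (K - J)) *
        (⨅ w : {w : Site (F.P K) 0 → Matrix.specialUnitaryGroup (Fin 2) ℂ |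
            ∀ U : GaugeField (F.P K) 0 (Matrix.specialUnitaryGroup (Fin 2) ℂ),
              descendTo F ℰp J K hlt.le (GaugeField.gaugeAct w U) = descendTo F ℰp J K hlt.le U},
          ∑ ℓ : PBond (F.P K) 0,
            dist1 (U ℓ * ((GaugeField.gaugeAct (w : Site (F.P K) 0 → Matrix.specialUnitaryGroup (Fin 2) ℂ) (1 : GaugeField (F.P K) 0 (Matrix.specialUnitaryGroup (Fin 2) ℂ))) ℓ)⁻¹) ^ 2)
        ≤ wilsonAction4 U - minActionRegPr F J K hlt.le ε₀ (1 : GaugeField (F.P J) 0 (Matrix.specialUnitaryGroup (Fin 2) ℂ))))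
    (V : GaugeField (F.P J) 0 (Matrix.specialUnitaryGroup (Fin 2) ℂ)) (x₀ : Site (F.P J) 0)
    (hcen : ∀ w : List (Letter (F.P J).d), walkEnd x₀ w = x₀ →
      ∀ M : Matrix (Fin 2) (Fin 2) ℂ, Commute ((holAt V (walk x₀ w) : Matrix.specialUnitaryGroup (Fin 2) ℂ) : Matrix (Fin 2) (Fin 2) ℂ) M)
    {δ : ℝ} (hδ : δ ≤ 2) (hV : PlaqSmall δ V)
    (U₀ : GaugeField (F.P K) 0 (Matrix.specialUnitaryGroup (Fin 2) ℂ)) (hU₀ : U₀ ∈ regFibrePr F J K hlt.le ε₀ V) (hcrit : IsCritR2 F J K hlt.le V U₀) :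
    (∀ U ∈ fibre F ℰp J K hlt.le V, U ∈ histGood F ℰp (θBal F.L γ b₀ p₀) K J →
      P U →
      c * ((F.L : ℝ)⁻¹) ^ (2 * (K - J)) *
        (⨅ w : {w : Site (F.P K) 0 → Matrix.specialUnitaryGroup (Fin 2) ℂ |
            ∀ U : GaugeField (F.P K) 0 (Matrix.specialUnitaryGroup (Fin 2) ℂ),
              descendTo F ℰp J K hlt.le (GaugeField.gaugeAct w U) = descendTo F ℰp J K hlt.le U},
          ∑ ℓ : PBond (F.P K) 0,
            dist1 (U ℓ * ((GaugeField.gaugeAct (w : Site (F.P K) 0 → Matrix.specialUnitaryGroup (Fin 2) ℂ) U₀) ℓ)⁻¹) ^ 2)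
        ≤ wilsonAction4 U - minActionRegPr F J K hlt.le ε₀ V) := by
  obtain ⟨g, l, u, -, hVg, hu, hU₀u⟩ := exists_residual_eq_gaugeAct_seamSectorRep F hlt hε₀ V x₀ hcen hδ hV U₀ hU₀ hcrit
  have hsec : ∀ lst : List (Fin 3), (∀ U ∈ fibre F ℰp J K hlt.le (lst.foldr (fun (ν : Fin 3) (X : GaugeField (F.P J) 0 (Matrix.specialUnitaryGroup (Fin 2) ℂ)) => fun c : PBond (F.P J) 0 =>
            (if c.dir = ν ∧ (c.src ν).val + 1 = (F.P J).sitesPerDir 0 then (⟨-1, neg_one_mem⟩ : Matrix.specialUnitaryGroup (Fin 2) ℂ) else 1) * X c) (1 : GaugeField (F.P J) 0 (Matrix.specialUnitaryGroup (Fin 2) ℂ))), U ∈ histGood F ℰp (θBal F.L γ b₀ p₀) K J →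
      P U →
      c * ((F.L : ℝ)⁻¹) ^ (2 * (K - J)) *
        (⨅ w : {w : Site (F.P K) 0 → Matrix.specialUnitaryGroup (Fin 2) ℂ |
            ∀ U : GaugeField (F.P K) 0 (Matrix.specialUnitaryGroup (Fin 2) ℂ),
              descendTo F ℰp J K hlt.le (GaugeField.gaugeAct w U) = descendTo F ℰp J K hlt.le U},
          ∑ ℓ : PBond (F.P K) 0,
            dist1 (U ℓ * ((GaugeField.gaugeAct (w : Site (F.P K) 0 → Matrix.specialUnitaryGroup (Fin 2) ℂ) (lst.foldr (fun (ν : Fin 3) (X : GaugeField (F.P K) 0 (Matrix.specialUnitaryGroup (Fin 2) ℂ)) => fun b : PBond (F.P K) 0 =>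
            (if b.dir = ν ∧ (b.src ν).val + 1 = (F.P K).sitesPerDir 0 then (⟨-1, neg_one_mem⟩ : Matrix.specialUnitaryGroup (Fin 2) ℂ) else 1) * X b) (1 : GaugeField (F.P K) 0 (Matrix.specialUnitaryGroup (Fin 2) ℂ)))) ℓ)⁻¹) ^ 2)
        ≤ wilsonAction4 U - minActionRegPr F J K hlt.le ε₀ (lst.foldr (fun (ν : Fin 3) (X : GaugeField (F.P J) 0 (Matrix.specialUnitaryGroup (Fin 2) ℂ)) => fun c : PBond (F.P J) 0 =>
            (if c.dir = ν ∧ (c.src ν).val + 1 = (F.P J).sitesPerDir 0 then (⟨-1, neg_one_mem⟩ : Matrix.specialUnitaryGroup (Fin 2) ℂ) else 1) * X c) (1 : GaugeField (F.P J) 0 (Matrix.specialUnitaryGroup (Fin 2) ℂ)))) := by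
    intro lst
    induction lst with
    | nil => exact h1
    | cons ν t ih =>
      rw [List.foldr_cons, List.foldr_cons]
      exact (gapAt_seamTwist_iff_guard F hlt.le _ negOne_mul_comm negOne_mul_negOne ν P (hPtw ν) _ _
        (by rw [minActionRegPr_seamFold_one F hlt.le hε₀ t]; exact minActionRegPr_seamFold_one F hlt.le hε₀ (ν :: t)) c).2 ih
  have h2 := (gapAt_gaugeAct_iff_guard F hlt.le (liftTransfTo F J K hlt.le g) hε₀.le P (hPg _) _ _ c).2 (hsec l)
  rw [descTransf_liftTransfTo] at h2
  have h3 := (gapAt_gaugeAct_iff_guard F hlt.le u hε₀.le P (hPg _) _ _ c).2 h2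
  rw [hu, gaugeAct_const_one, ← hVg, ← hU₀u] at h3
  exact h3

/-- ★★★★ **GAP♭ (✓p799103's body): FROM THE FLAT DATUM TO EVERY CASE-B `(V, U₀)`, POINTWISE** (fixed `(F, γ, b₀, p₀, J, K, ε₀, c)`; same hypotheses on `V, U₀`).
[cite: Balaban1985Variational, (142) p.299, Prop. 7 p.299; Balaban1984PropagatorsII, (1.33); Balaban1985UV3, (12)-(13) p.259] -/
theorem gapFlatAt_caseB_of_flat (hlt : J < K) {γ b₀ p₀ ε₀ : ℝ} (hε₀ : 0 < ε₀) (c : ℝ)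
    (h1 : (∀ U ∈ fibre F ℰp J K hlt.le (1 : GaugeField (F.P J) 0 (Matrix.specialUnitaryGroup (Fin 2) ℂ)), U ∈ histGood F ℰp (θBal F.L γ b₀ p₀) K J →
      c * ((F.L : ℝ)⁻¹) ^ (2 * (K - J)) *
        (⨅ w : {w : Site (F.P K) 0 → Matrix.specialUnitaryGroup (Fin 2) ℂ |
            ∀ U : GaugeField (F.P K) 0 (Matrix.specialUnitaryGroup (Fin 2) ℂ),
              descendTo F ℰp J K hlt.le (GaugeField.gaugeAct w U) = descendTo F ℰp J K hlt.le U},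
          ∑ ℓ : PBond (F.P K) 0,
            dist1 (U ℓ * ((GaugeField.gaugeAct (w : Site (F.P K) 0 → Matrix.specialUnitaryGroup (Fin 2) ℂ) (1 : GaugeField (F.P K) 0 (Matrix.specialUnitaryGroup (Fin 2) ℂ))) ℓ)⁻¹) ^ 2)
        ≤ wilsonAction4 U - minActionRegPr F J K hlt.le ε₀ (1 : GaugeField (F.P J) 0 (Matrix.specialUnitaryGroup (Fin 2) ℂ))))
    (V : GaugeField (F.P J) 0 (Matrix.specialUnitaryGroup (Fin 2) ℂ)) (x₀ : Site (F.P J) 0)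
    (hcen : ∀ w : List (Letter (F.P J).d), walkEnd x₀ w = x₀ →
      ∀ M : Matrix (Fin 2) (Fin 2) ℂ, Commute ((holAt V (walk x₀ w) : Matrix.specialUnitaryGroup (Fin 2) ℂ) : Matrix (Fin 2) (Fin 2) ℂ) M)
    {δ : ℝ} (hδ : δ ≤ 2) (hV : PlaqSmall δ V)
    (U₀ : GaugeField (F.P K) 0 (Matrix.specialUnitaryGroup (Fin 2) ℂ)) (hU₀ : U₀ ∈ regFibrePr F J K hlt.le ε₀ V) (hcrit : IsCritR2 F J K hlt.le V U₀) :
    (∀ U ∈ fibre F ℰp J K hlt.le V, U ∈ histGood F ℰp (θBal F.L γ b₀ p₀) K J →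
      c * ((F.L : ℝ)⁻¹) ^ (2 * (K - J)) *
        (⨅ w : {w : Site (F.P K) 0 → Matrix.specialUnitaryGroup (Fin 2) ℂ |
            ∀ U : GaugeField (F.P K) 0 (Matrix.specialUnitaryGroup (Fin 2) ℂ),
              descendTo F ℰp J K hlt.le (GaugeField.gaugeAct w U) = descendTo F ℰp J K hlt.le U},
          ∑ ℓ : PBond (F.P K) 0,
            dist1 (U ℓ * ((GaugeField.gaugeAct (w : Site (F.P K) 0 → Matrix.specialUnitaryGroup (Fin 2) ℂ) U₀) ℓ)⁻¹) ^ 2)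
        ≤ wilsonAction4 U - minActionRegPr F J K hlt.le ε₀ V) := by
  obtain ⟨g, l, u, -, hVg, hu, hU₀u⟩ := exists_residual_eq_gaugeAct_seamSectorRep F hlt hε₀ V x₀ hcen hδ hV U₀ hU₀ hcrit
  have hsec : ∀ lst : List (Fin 3), (∀ U ∈ fibre F ℰp J K hlt.le (lst.foldr (fun (ν : Fin 3) (X : GaugeField (F.P J) 0 (Matrix.specialUnitaryGroup (Fin 2) ℂ)) => fun c : PBond (F.P J) 0 =>
            (if c.dir = ν ∧ (c.src ν).val + 1 = (F.P J).sitesPerDir 0 then (⟨-1, neg_one_mem⟩ : Matrix.specialUnitaryGroup (Fin 2) ℂ) else 1) * X c) (1 : GaugeField (F.P J) 0 (Matrix.specialUnitaryGroup (Fin 2) ℂ))), U ∈ histGood F ℰp (θBal F.L γ b₀ p₀) K J →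
      c * ((F.L : ℝ)⁻¹) ^ (2 * (K - J)) *
        (⨅ w : {w : Site (F.P K) 0 → Matrix.specialUnitaryGroup (Fin 2) ℂ |
            ∀ U : GaugeField (F.P K) 0 (Matrix.specialUnitaryGroup (Fin 2) ℂ),
              descendTo F ℰp J K hlt.le (GaugeField.gaugeAct w U) = descendTo F ℰp J K hlt.le U},
          ∑ ℓ : PBond (F.P K) 0,
            dist1 (U ℓ * ((GaugeField.gaugeAct (w : Site (F.P K) 0 → Matrix.specialUnitaryGroup (Fin 2) ℂ) (lst.foldr (fun (ν : Fin 3) (X : GaugeField (F.P K) 0 (Matrix.specialUnitaryGroup (Fin 2) ℂ)) => fun b : PBond (F.P K) 0 =>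
            (if b.dir = ν ∧ (b.src ν).val + 1 = (F.P K).sitesPerDir 0 then (⟨-1, neg_one_mem⟩ : Matrix.specialUnitaryGroup (Fin 2) ℂ) else 1) * X b) (1 : GaugeField (F.P K) 0 (Matrix.specialUnitaryGroup (Fin 2) ℂ)))) ℓ)⁻¹) ^ 2)
        ≤ wilsonAction4 U - minActionRegPr F J K hlt.le ε₀ (lst.foldr (fun (ν : Fin 3) (X : GaugeField (F.P J) 0 (Matrix.specialUnitaryGroup (Fin 2) ℂ)) => fun c : PBond (F.P J) 0 =>
            (if c.dir = ν ∧ (c.src ν).val + 1 = (F.P J).sitesPerDir 0 then (⟨-1, neg_one_mem⟩ : Matrix.specialUnitaryGroup (Fin 2) ℂ) else 1) * X c) (1 : GaugeField (F.P J) 0 (Matrix.specialUnitaryGroup (Fin 2) ℂ)))) := by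
    intro lst
    induction lst with
    | nil => exact h1
    | cons ν t ih =>
      rw [List.foldr_cons, List.foldr_cons]
      exact (gapFlatAt_seamTwist_iff F hlt.le _ negOne_mul_comm negOne_mul_negOne ν (γ := γ) (b₀ := b₀) (p₀ := p₀) _ _
        (by rw [minActionRegPr_seamFold_one F hlt.le hε₀ t]; exact minActionRegPr_seamFold_one F hlt.le hε₀ (ν :: t)) c).2 ih
  have h2 := (gapFlatAt_gaugeAct_iff F hlt.le (liftTransfTo F J K hlt.le g) (γ := γ) (b₀ := b₀) (p₀ := p₀) hε₀.le _ _ c).2 (hsec l)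
  rw [descTransf_liftTransfTo] at h2
  have h3 := (gapFlatAt_gaugeAct_iff F hlt.le u (γ := γ) (b₀ := b₀) (p₀ := p₀) hε₀.le _ _ c).2 h2
  rw [hu, gaugeAct_const_one, ← hVg, ← hU₀u] at h3
  exact h3

/-- ★★★★ **TUBE♭ (✓p799103's body): FROM THE FLAT DATUM TO EVERY CASE-B `(V, U₀)`, POINTWISE** (fixed `(F, γ, b₀, p₀, J, K, ε₀, δ', c)`; same hypotheses on `V, U₀`).
[cite: Balaban1985Variational, (142) p.299, Prop. 7 p.299; Balaban1985UV3, (12)-(13) p.259, (18)-(22) p.260] -/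
theorem tubeGrowthAt_caseB_of_flat (hlt : J < K) {γ b₀ p₀ ε₀ : ℝ} (hε₀ : 0 < ε₀) (δ' c : ℝ)
    (h1 : (∀ U ∈ fibre F ℰp J K hlt.le (1 : GaugeField (F.P J) 0 (Matrix.specialUnitaryGroup (Fin 2) ℂ)), U ∈ histGood F ℰp (θBal F.L γ b₀ p₀) K J →
      (∃ w : Site (F.P K) 0 → Matrix.specialUnitaryGroup (Fin 2) ℂ,
        (∀ U'' : GaugeField (F.P K) 0 (Matrix.specialUnitaryGroup (Fin 2) ℂ),
          descendTo F ℰp J K hlt.le (GaugeField.gaugeAct w U'') = descendTo F ℰp J K hlt.le U'') ∧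
        ∀ ℓ : PBond (F.P K) 0, dist1 (U ℓ * ((GaugeField.gaugeAct w (1 : GaugeField (F.P K) 0 (Matrix.specialUnitaryGroup (Fin 2) ℂ))) ℓ)⁻¹) ≤ δ') →
      c * ((F.L : ℝ)⁻¹) ^ (2 * (K - J)) *
        (⨅ w : {w : Site (F.P K) 0 → Matrix.specialUnitaryGroup (Fin 2) ℂ |
            ∀ U : GaugeField (F.P K) 0 (Matrix.specialUnitaryGroup (Fin 2) ℂ),
              descendTo F ℰp J K hlt.le (GaugeField.gaugeAct w U) = descendTo F ℰp J K hlt.le U},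
          ∑ ℓ : PBond (F.P K) 0,
            dist1 (U ℓ * ((GaugeField.gaugeAct (w : Site (F.P K) 0 → Matrix.specialUnitaryGroup (Fin 2) ℂ) (1 : GaugeField (F.P K) 0 (Matrix.specialUnitaryGroup (Fin 2) ℂ))) ℓ)⁻¹) ^ 2)
        ≤ wilsonAction4 U - minActionRegPr F J K hlt.le ε₀ (1 : GaugeField (F.P J) 0 (Matrix.specialUnitaryGroup (Fin 2) ℂ))))
    (V : GaugeField (F.P J) 0 (Matrix.specialUnitaryGroup (Fin 2) ℂ)) (x₀ : Site (F.P J) 0)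
    (hcen : ∀ w : List (Letter (F.P J).d), walkEnd x₀ w = x₀ →
      ∀ M : Matrix (Fin 2) (Fin 2) ℂ, Commute ((holAt V (walk x₀ w) : Matrix.specialUnitaryGroup (Fin 2) ℂ) : Matrix (Fin 2) (Fin 2) ℂ) M)
    {δ : ℝ} (hδ : δ ≤ 2) (hV : PlaqSmall δ V)
    (U₀ : GaugeField (F.P K) 0 (Matrix.specialUnitaryGroup (Fin 2) ℂ)) (hU₀ : U₀ ∈ regFibrePr F J K hlt.le ε₀ V) (hcrit : IsCritR2 F J K hlt.le V U₀) :
    (∀ U ∈ fibre F ℰp J K hlt.le V, U ∈ histGood F ℰp (θBal F.L γ b₀ p₀) K J →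
      (∃ w : Site (F.P K) 0 → Matrix.specialUnitaryGroup (Fin 2) ℂ,
        (∀ U'' : GaugeField (F.P K) 0 (Matrix.specialUnitaryGroup (Fin 2) ℂ),
          descendTo F ℰp J K hlt.le (GaugeField.gaugeAct w U'') = descendTo F ℰp J K hlt.le U'') ∧
        ∀ ℓ : PBond (F.P K) 0, dist1 (U ℓ * ((GaugeField.gaugeAct w U₀) ℓ)⁻¹) ≤ δ') →
      c * ((F.L : ℝ)⁻¹) ^ (2 * (K - J)) *
        (⨅ w : {w : Site (F.P K) 0 → Matrix.specialUnitaryGroup (Fin 2) ℂ |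
            ∀ U : GaugeField (F.P K) 0 (Matrix.specialUnitaryGroup (Fin 2) ℂ),
              descendTo F ℰp J K hlt.le (GaugeField.gaugeAct w U) = descendTo F ℰp J K hlt.le U},
          ∑ ℓ : PBond (F.P K) 0,
            dist1 (U ℓ * ((GaugeField.gaugeAct (w : Site (F.P K) 0 → Matrix.specialUnitaryGroup (Fin 2) ℂ) U₀) ℓ)⁻¹) ^ 2)
        ≤ wilsonAction4 U - minActionRegPr F J K hlt.le ε₀ V) := by
  obtain ⟨g, l, u, -, hVg, hu, hU₀u⟩ := exists_residual_eq_gaugeAct_seamSectorRep F hlt hε₀ V x₀ hcen hδ hV U₀ hU₀ hcrit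
  have hsec : ∀ lst : List (Fin 3), (∀ U ∈ fibre F ℰp J K hlt.le (lst.foldr (fun (ν : Fin 3) (X : GaugeField (F.P J) 0 (Matrix.specialUnitaryGroup (Fin 2) ℂ)) => fun c : PBond (F.P J) 0 =>
            (if c.dir = ν ∧ (c.src ν).val + 1 = (F.P J).sitesPerDir 0 then (⟨-1, neg_one_mem⟩ : Matrix.specialUnitaryGroup (Fin 2) ℂ) else 1) * X c) (1 : GaugeField (F.P J) 0 (Matrix.specialUnitaryGroup (Fin 2) ℂ))), U ∈ histGood F ℰp (θBal F.L γ b₀ p₀) K J →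
      (∃ w : Site (F.P K) 0 → Matrix.specialUnitaryGroup (Fin 2) ℂ,
        (∀ U'' : GaugeField (F.P K) 0 (Matrix.specialUnitaryGroup (Fin 2) ℂ),
          descendTo F ℰp J K hlt.le (GaugeField.gaugeAct w U'') = descendTo F ℰp J K hlt.le U'') ∧
        ∀ ℓ : PBond (F.P K) 0, dist1 (U ℓ * ((GaugeField.gaugeAct w (lst.foldr (fun (ν : Fin 3) (X : GaugeField (F.P K) 0 (Matrix.specialUnitaryGroup (Fin 2) ℂ)) => fun b : PBond (F.P K) 0 =>
            (if b.dir = ν ∧ (b.src ν).val + 1 = (F.P K).sitesPerDir 0 then (⟨-1, neg_one_mem⟩ : Matrix.specialUnitaryGroup (Fin 2) ℂ) else 1) * X b) (1 : GaugeField (F.P K) 0 (Matrix.specialUnitaryGroup (Fin 2) ℂ)))) ℓ)⁻¹) ≤ δ') →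
      c * ((F.L : ℝ)⁻¹) ^ (2 * (K - J)) *
        (⨅ w : {w : Site (F.P K) 0 → Matrix.specialUnitaryGroup (Fin 2) ℂ |
            ∀ U : GaugeField (F.P K) 0 (Matrix.specialUnitaryGroup (Fin 2) ℂ),
              descendTo F ℰp J K hlt.le (GaugeField.gaugeAct w U) = descendTo F ℰp J K hlt.le U},
          ∑ ℓ : PBond (F.P K) 0,
            dist1 (U ℓ * ((GaugeField.gaugeAct (w : Site (F.P K) 0 → Matrix.specialUnitaryGroup (Fin 2) ℂ) (lst.foldr (fun (ν : Fin 3) (X : GaugeField (F.P K) 0 (Matrix.specialUnitaryGroup (Fin 2) ℂ)) => fun b : PBond (F.P K) 0 =>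
            (if b.dir = ν ∧ (b.src ν).val + 1 = (F.P K).sitesPerDir 0 then (⟨-1, neg_one_mem⟩ : Matrix.specialUnitaryGroup (Fin 2) ℂ) else 1) * X b) (1 : GaugeField (F.P K) 0 (Matrix.specialUnitaryGroup (Fin 2) ℂ)))) ℓ)⁻¹) ^ 2)
        ≤ wilsonAction4 U - minActionRegPr F J K hlt.le ε₀ (lst.foldr (fun (ν : Fin 3) (X : GaugeField (F.P J) 0 (Matrix.specialUnitaryGroup (Fin 2) ℂ)) => fun c : PBond (F.P J) 0 =>
            (if c.dir = ν ∧ (c.src ν).val + 1 = (F.P J).sitesPerDir 0 then (⟨-1, neg_one_mem⟩ : Matrix.specialUnitaryGroup (Fin 2) ℂ) else 1) * X c) (1 : GaugeField (F.P J) 0 (Matrix.specialUnitaryGroup (Fin 2) ℂ)))) := by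
    intro lst
    induction lst with
    | nil => exact h1
    | cons ν t ih =>
      rw [List.foldr_cons, List.foldr_cons]
      exact (tubeGrowthAt_seamTwist_iff F hlt.le _ negOne_mul_comm negOne_mul_negOne ν (γ := γ) (b₀ := b₀) (p₀ := p₀) _ _
        (by rw [minActionRegPr_seamFold_one F hlt.le hε₀ t]; exact minActionRegPr_seamFold_one F hlt.le hε₀ (ν :: t)) δ' c).2 ih
  have h2 := (tubeGrowthAt_gaugeAct_iff F hlt.le (liftTransfTo F J K hlt.le g) (γ := γ) (b₀ := b₀) (p₀ := p₀) hε₀.le _ _ δ' c).2 (hsec l)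
  rw [descTransf_liftTransfTo] at h2
  have h3 := (tubeGrowthAt_gaugeAct_iff F hlt.le u (γ := γ) (b₀ := b₀) (p₀ := p₀) hε₀.le _ _ δ' c).2 h2
  rw [hu, gaugeAct_const_one, ← hVg, ← hU₀u] at h3
  exact h3

end Summit.QuantumFields.YangMills.Theorems.FluctuationComparisonRegPrIntLS2BetaCaseBTransportPointwise

end
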